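import Summits.QuantumFields.YangMills.Theorems.FluctuationComparisonRegPrIntLOrganTangentDwhiteOfDecayingTubeOperator
import HarnessLib

/-!
# Crux `FluctuationComparisonRegPrIntL` (stmt-QuantumFields-20520, rung R3), PATH-B organ (covariant organ of record, RULING №56) — (L63) «L2-b FROM L2-a + SYMMETRY + THE
# REAL OPERATOR'S DECAY»: the (K-sqrt-decay) letter of ✓(L59)∕✓(L62) — «`‖invSqrt ((K V′).map ofReal) i j′‖ ≤ B·e^{−ρ d₁(loc i, loc j′)}`», UV3-NODE §92.2 L2-b (real-slice
# decay of the whitening kernel `K_{V′}^{−1∕2}`) — is DERIVED, with torus-size-free constants `(B, ρ) := (2(√(γK − ρct))⁻¹, κ∕2)`, from three letters on the REAL operator: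
# (K-symm) «`K V′` is symmetric» (a Hessian), (K-coer) «`Coercive (K V′) γK`» = L2-a REAL AS PRINTED ([Balaban1985BackgroundPropagators] Thm 3.11 p.416 ∕ p.428), and
# (K-decay-real) «`|K V′ i j′| ≤ aK·e^{−κK d₁(loc i, loc j′)}`» (the real operator's own kernel decay, [Balaban1985BackgroundPropagators] Thm 3.10 (3.107)–(3.108)'s operator
# half), plus a rate `0 ≤ κ < κK` with the COMBES–THOMAS smallness `aK·κ·(2∕(e(κK − κ)))·(mf·c₀(1,(κK − κ)∕2)^ν) ≤ ρct < γK` — BY NAME over lit ✓`B13Sqrt27.abs_invSqrt_apply_le_of_decay_exp`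
# ([Balaban1988RG2Cluster] (2.7) p.13: «The resolvent … can be expanded … This yields an expansion of (C^{(k)})^{1∕2} also» — the square root inherits HALF the resolvent's rate,
# ∘ ✓`B9SectEKernel.resolvent_decay_uniform`), ✓`B13Sqrt27Accretive.invSqrt_map_ofReal`, ✓`B13Sqrt27.posDef_of_coercive`, ✓`B13LocalKernelWalks.rowSum_torus`.

Cell `ym3-torus` (YM ladder rung R3 = continuum `SU(2)` Yang–Mills on the three-torus — a RUNG: NOT d = 4, NOT infinite volume, NOT a mass gap, NOT Clay).
Width seat `ym-ust-20520-w5` (gen 27), `--kind proof --supports stmt-QuantumFields-20520 --as helper`, count-neutral, DEFINITION-FREE, default heartbeats,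
no registry ∕ binder ∕ `Lines/` edit.  Over ✓p834297 (L62) `…OrganTangentDwhiteOfDecayingTubeOperator` (this seat) and the lit modules named above.

HONEST CAVEAT FIRST (UV3-NODE §62.4 (iii) ∕ §92.2): Combes–Thomas yields a decay rate `~ gap ∕ bandwidth` PER INDEX STEP.  On the FINE-bond-indexed `Δ_a` (bandwidth `~ η⁻²`,
`η = L^{−m}`) that rate is `~ η²` per fine bond — useless at depth; THIS door is stated for the UNIT-LATTICE-indexed operator of the whitened chart (`loc : p → UT Nf` the unit
torus; `K_V ↔ C*Δ_kC`, [Balaban1988RG2Cluster] (2.5)–(2.6), UV3-NODE §99), where `γK`, `aK`, `κK` `= O(1)` ARE the m-uniform letters — L2-a and the operator-kernel half of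
[Balaban1985BackgroundPropagators] Thm 3.10 — print's, OPEN.  So (L63) REDUCES L2-b to {L2-a, (K-decay-real), symmetry}; it does not prove L2-b.

THE LETTERS AFTER (L63) (hypothesis texts; `θ⁺ := θ_j + 4·√3·R₁` the enlarged window of ✓(L59) §3): (K-tube-holo) + (K-decay) on the tubes (L2-c, as in ✓(L62)); (K-real) on `θ⁺`;
(K-symm) `(K V′).IsHermitian`, (K-coer) `Coercive (K V′) γK` and (K-decay-real) `|K V′ i j′| ≤ aK·e^{−κK d₁}` on `θ⁺`; a rate `κ` with `0 ≤ κ < κK` and the Combes–Thomas budget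
`hct`, `hρct : ρct < γK`; (Wh-read-K); (z-window∣MW), `kW`; `hkW` read at `(B, ρ) := (2(√(γK − ρct))⁻¹, κ∕2)`; radii as in ✓(L62).
INHABITATION (★★OWNER RULING №100): LAW-FREE — statements about the chart objects `Kc`, `K`, `Wh`, `coord`; no fibre law, no score, no cross-law object.

WHAT (sorry-free, def-free; `d₁ = tdist1` on the unit torus `UT Nf`, a pseudo-metric: ✓`tdist1_self ∕ _comm ∕ _triangle`).
* §1 ★★`norm_invSqrt_map_le_of_coercive_ct` — for a REAL symmetric `γ`-coercive `T` whose `(e^{κ d₁} − 1)`-weighted absolute row AND column sums are `≤ ρct < γ`: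
  `‖invSqrt (T.map ofReal) i j‖ ≤ 2(√(γ − ρct))⁻¹·e^{−(κ∕2)·d₁(loc i, loc j)}` (lit's (2.7) chain: `invSqrt_map_ofReal` at the `PosDef` point `posDef_of_coercive`, then
  `abs_invSqrt_apply_le_of_decay_exp`).
* §2 ★`ct_term_le` (pointwise: `|t| ≤ a·e^{−κ₀ d}`, `0 ≤ d`, `0 ≤ κ < κ₀` ⟹ `|t|·(e^{κd} − 1) ≤ a·κ·(2∕(e(κ₀−κ)))·e^{−((κ₀−κ)∕2) d}`, from `e^y − 1 ≤ y e^y` and `x e^{−x} ≤ e^{−1}`),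
  ★★`ctRowSum_le_of_expMajorant` ∕ ★★`ctColSum_le_of_expMajorant` — the Combes–Thomas weighted sums of a matrix with an exponential majorant are
  `≤ a·κ·(2∕(e(κ₀−κ)))·(mf·c₀(1,(κ₀−κ)∕2)^ν)`, EVERY torus size (lit ✓`rowSum_decay_le` ∕ ✓`colSum_decay_le` ∘ ✓`rowSum_torus`) — small for small `κ`.
* §3 ★★★`dwhite_of_symmetricDecayingOperator` — ✓(L62) `dwhite_of_decayingTubeOperator` with `(ρ B) (hB0 hρ) (hdec)` DELETED and `(aK κK κ ρct) (haK) (hκ) (hκK) (hct) (hρct)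
  (hKs) (hcoerp) (hKd)` in their place ((K-coer) now on `θ⁺`, its centre form derived by ✓`plaqSmall_mono`); `hkW` at `(B, ρ) := (2(√(γK − ρct))⁻¹, κ∕2)`; CONCLUSION = ✓(L52)'s =
  ✓(L50b)'s `hDwhite` text VERBATIM.  Proof: §2 feeds §1 at every `θ⁺`-small `V′`, then ✓(L62) by name.
NET: D0's whitening letters = {(K-tube-holo) + (K-decay) = L2-c; (K-real); (K-symm); (K-coer) = L2-a; (K-decay-real) = the real kernel half of Thm 3.10; CT budget; (Wh-read-K);
(z-window∣MW)} — L2-b is no longer an independent letter on this side.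

HONEST FRAMING: [folklore] real analysis + lit's kernel-checked (2.7)∕Combes–Thomas chain; nothing of Bałaban's operators constructed or asserted; every (K-·) letter OPEN (D0 =
19200 EX ∧ V2′; [Balaban1985BackgroundPropagators] §3); (Dmin), (χ-Lip∣MW), (I-curv), (I-cov), KER′ letters, rows v0.1–v0.4ᴱ UNDISCHARGED; the five registered stubs of
`Lines/semiclassical_s2beta.lean`, crux 20520 and `YM3TorusSU2` are NOT proved; registry untouched; rung R3 = SU(2) YM₃ on T³ — NOT d = 4, NOT infinite volume, NOT a mass gap,
NOT Clay; the Yang–Mills mass gap is NOT proved.  [folklore]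

References: T. Bałaban, CMP **116** (1988) 1–22 [Balaban1988RG2Cluster] ((2.5)–(2.7) pp.12–13, p.15); CMP **99** (1985) 389–434 [Balaban1985BackgroundPropagators] (Thm 3.4
p.400, Thm 3.10 (3.107)–(3.108) pp.415–416, Thm 3.11 p.416, p.428); CMP **96** (1984) 223–250 [Balaban1984PropagatorsII] (Lemma 2.1 (2.61) p.234); CMP **109** (1987) 249–301
[Balaban1987RG1] ((1.11)–(1.18) pp.262–263).
-/

set_option autoImplicit false

noncomputable section

namespace Summit.QuantumFields.YangMills.Theorems.OrganTangentSqrtDecayOfRealDecay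

open Function Set Metric Finset
open scoped NNReal Matrix Matrix.Norms.L2Operator
open Literature.MathematicalPhysics.QuantumFieldTheory
open Literature.MathematicalPhysics.QuantumFieldTheory.Balaban1983to89 T3ContinuumYM3Torus T3NestedUnitLaws
  T3UnitLawDensityEML T4Continuum BalabanUVClass T3UnitScaleTilt T3LevelShift T3TiltDescent
open T4CubeChartExp (expPt)
open BalabanUVClass (CplxModel)
open Literature.MathematicalPhysics.QuantumFieldTheory.Balaban1983to89.B9Thm37GlueTorus (tdist1 tdist1_self tdist1_comm tdist1_triangle tdist1_nonneg)
open Literature.MathematicalPhysics.QuantumFieldTheory.Balaban1983to89.B5TorusCover (UT)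
open Literature.MathematicalPhysics.QuantumFieldTheory.Balaban1983to89.B13Sqrt27Accretive (invSqrt invSqrt_map_ofReal)
open Literature.MathematicalPhysics.QuantumFieldTheory.Balaban1983to89.B13Sqrt27 (posDef_of_coercive abs_invSqrt_apply_le_of_decay_exp)
open Literature.MathematicalPhysics.QuantumFieldTheory.Balaban1983to89.B13RealSliceEntryLetters (realStructureComplex lam)
open Literature.MathematicalPhysics.QuantumFieldTheory.Balaban1983to89.QGQInverse (Coercive)
open Literature.MathematicalPhysics.QuantumFieldTheory.Balaban1983to89.B13AccretiveOfRealCoercive (rowSum_decay_le colSum_decay_le)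
open Literature.MathematicalPhysics.QuantumFieldTheory.Balaban1983to89.B13LocalKernelWalks (rowSum_torus)
open Summit.QuantumFields.YangMills.Theorems.OrganTangentILawKnitFacts (plaqSmall_mono)
open Summit.QuantumFields.YangMills.Theorems.OrganTangentDwhiteOfDecayingTubeOperator (dwhite_of_decayingTubeOperator)

/-! ## §1 The square-root kernel of a real symmetric coercive matrix: half the Combes–Thomas rate -/

section Sqrt

variable {ν : ℕ} {Nf : Fin ν → ℕ} [∀ i, NeZero (Nf i)]
variable {p : Type} [Fintype p] [DecidableEq p]

/-- ★★ **L2-b FROM L2-a + SYMMETRY + COMBES–THOMAS**: for a REAL symmetric `γ`-coercive `T` whose `(e^{κ d₁} − 1)`-weighted absolute row and column sums are `≤ ρct < γ`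
(`κ ≥ 0`, `d₁` the unit-torus distance through `loc`): `‖invSqrt (T.map ofReal) i j‖ ≤ 2(√(γ − ρct))⁻¹·e^{−(κ∕2)·d₁(loc i, loc j)}` — lit's (2.7) chain by name
(`invSqrt_map_ofReal` at the `PosDef` point, `abs_invSqrt_apply_le_of_decay_exp` ∘ `resolvent_decay_uniform`).
[cite: Balaban1988RG2Cluster, (2.7) p.13, p.15; Balaban1985BackgroundPropagators, Thm 3.10 (3.108) p.416, Thm 3.11 p.416] -/
theorem norm_invSqrt_map_le_of_coercive_ct (loc : p → UT Nf) {T : Matrix p p ℝ} (hTs : T.IsHermitian)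
    {γ κ ρct : ℝ} (hργ : ρct < γ) (hκ : 0 ≤ κ) (hc : Coercive T γ)
    (hrow : ∀ i, ∑ j, |T i j| * (Real.exp (κ * tdist1 Nf (loc i) (loc j)) - 1) ≤ ρct)
    (hcol : ∀ j, ∑ i, |T i j| * (Real.exp (κ * tdist1 Nf (loc i) (loc j)) - 1) ≤ ρct) (i j : p) :
    ‖invSqrt (T.map (algebraMap ℝ ℂ)) i j‖ ≤ 2 * (Real.sqrt (γ - ρct))⁻¹ * Real.exp (-(κ / 2 * tdist1 Nf (loc i) (loc j))) := by
  have hρ0 : 0 ≤ ρct := le_trans (Finset.sum_nonneg fun k _ => mul_nonneg (abs_nonneg _)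
    (sub_nonneg.2 (Real.one_le_exp (mul_nonneg hκ (tdist1_nonneg _ _))))) (hrow i)
  have hγ : 0 < γ := hρ0.trans_lt hργ
  have hT : T.PosDef := posDef_of_coercive hTs hγ hc
  rw [invSqrt_map_ofReal hT, Matrix.map_apply, Complex.coe_algebraMap, Complex.norm_real, Real.norm_eq_abs]
  have h := abs_invSqrt_apply_le_of_decay_exp hTs (fun i j => tdist1 Nf (loc i) (loc j)) hργ hκ hc
    (fun i j => tdist1_comm _ _) (fun i => tdist1_self _) (fun i j k => tdist1_triangle _ _ _) hrow hcol i j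
  refine h.trans (le_of_eq ?_)
  congr 1
  ring_nf

end Sqrt

/-! ## §2 The Combes–Thomas budget of a matrix with an exponential majorant, every torus size -/

section CT

variable {ν : ℕ} {Nf : Fin ν → ℕ} [∀ i, NeZero (Nf i)]
variable {p : Type} [Fintype p]

/-- ★ **ONE TERM**: `|t| ≤ a·e^{−κ₀ d}`, `0 ≤ d`, `0 ≤ κ < κ₀` ⟹ `|t|·(e^{κ d} − 1) ≤ a·κ·(2∕(e(κ₀−κ)))·e^{−((κ₀−κ)∕2) d}` (`e^y − 1 ≤ y e^y`; `x e^{−x} ≤ e^{−1}`). [folklore]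
[cite: Balaban1984PropagatorsII, Lemma 2.1 (2.61) p.234] -/
theorem ct_term_le {t a κ₀ κ d : ℝ} (ht : |t| ≤ a * Real.exp (-(κ₀ * d))) (hd : 0 ≤ d) (hκ : 0 ≤ κ) (hκκ₀ : κ < κ₀) :
    |t| * (Real.exp (κ * d) - 1) ≤ a * κ * (2 / (Real.exp 1 * (κ₀ - κ))) * Real.exp (-((κ₀ - κ) / 2 * d)) := by
  have hα : 0 < κ₀ - κ := sub_pos.2 hκκ₀
  have ha : 0 ≤ a := by
    have h0 : 0 ≤ a * Real.exp (-(κ₀ * d)) := (abs_nonneg t).trans ht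
    exact nonneg_of_mul_nonneg_left (by rwa [mul_comm] at h0) (Real.exp_pos _)
  -- `e^y − 1 ≤ y e^y`
  have hexp : ∀ y : ℝ, Real.exp y - 1 ≤ y * Real.exp y := by
    intro y
    have h := Real.add_one_le_exp (-y)
    have hpos := Real.exp_pos y
    have : Real.exp (-y) * Real.exp y = 1 := by rw [← Real.exp_add, neg_add_cancel, Real.exp_zero]
    nlinarith [mul_le_mul_of_nonneg_right h hpos.le]
  -- `x e^{−x} ≤ e^{−1}`
  have hxe : ∀ x : ℝ, x * Real.exp (-x) ≤ Real.exp (-1) := by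
    intro x
    have h := Real.add_one_le_exp (x - 1)
    have hx : Real.exp (x - 1) = Real.exp x * Real.exp (-1) := by rw [← Real.exp_add]; ring_nf
    have h2 : x ≤ Real.exp x * Real.exp (-1) := by linarith
    calc x * Real.exp (-x) ≤ Real.exp x * Real.exp (-1) * Real.exp (-x) :=
          mul_le_mul_of_nonneg_right h2 (Real.exp_pos _).le
      _ = Real.exp (-1) := by
          rw [mul_assoc, mul_comm (Real.exp (-1)), ← mul_assoc, ← Real.exp_add, add_neg_cancel, Real.exp_zero, one_mul]
  -- `d e^{−α d} ≤ (2∕(e α)) e^{−α d∕2}`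
  have hde : d * Real.exp (-((κ₀ - κ) * d)) ≤ 2 / (Real.exp 1 * (κ₀ - κ)) * Real.exp (-((κ₀ - κ) / 2 * d)) := by
    have h1 := hxe ((κ₀ - κ) / 2 * d)
    have he : Real.exp (-((κ₀ - κ) * d)) = Real.exp (-((κ₀ - κ) / 2 * d)) * Real.exp (-((κ₀ - κ) / 2 * d)) := by
      rw [← Real.exp_add]; ring_nf
    rw [he, ← mul_assoc]
    refine mul_le_mul_of_nonneg_right ?_ (Real.exp_pos _).le
    have h2 : d * Real.exp (-((κ₀ - κ) / 2 * d)) = 2 / (κ₀ - κ) * ((κ₀ - κ) / 2 * d * Real.exp (-((κ₀ - κ) / 2 * d))) := by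
      field_simp
    rw [h2]
    calc 2 / (κ₀ - κ) * ((κ₀ - κ) / 2 * d * Real.exp (-((κ₀ - κ) / 2 * d))) ≤ 2 / (κ₀ - κ) * Real.exp (-1) :=
          mul_le_mul_of_nonneg_left h1 (by positivity)
      _ = 2 / (Real.exp 1 * (κ₀ - κ)) := by rw [Real.exp_neg, div_mul_eq_div_div]; field_simp
  have h1 : Real.exp (κ * d) - 1 ≤ κ * d * Real.exp (κ * d) := hexp (κ * d)
  have h2 : 0 ≤ Real.exp (κ * d) - 1 := sub_nonneg.2 (Real.one_le_exp (mul_nonneg hκ hd))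
  calc |t| * (Real.exp (κ * d) - 1) ≤ a * Real.exp (-(κ₀ * d)) * (κ * d * Real.exp (κ * d)) :=
        mul_le_mul ht h1 h2 (by positivity)
    _ = a * κ * (d * Real.exp (-((κ₀ - κ) * d))) := by
        have : Real.exp (-(κ₀ * d)) * Real.exp (κ * d) = Real.exp (-((κ₀ - κ) * d)) := by
          rw [← Real.exp_add]; ring_nf
        calc a * Real.exp (-(κ₀ * d)) * (κ * d * Real.exp (κ * d))
            = a * κ * (d * (Real.exp (-(κ₀ * d)) * Real.exp (κ * d))) := by ring
          _ = a * κ * (d * Real.exp (-((κ₀ - κ) * d))) := by rw [this]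
    _ ≤ a * κ * (2 / (Real.exp 1 * (κ₀ - κ)) * Real.exp (-((κ₀ - κ) / 2 * d))) :=
        mul_le_mul_of_nonneg_left hde (by positivity)
    _ = a * κ * (2 / (Real.exp 1 * (κ₀ - κ))) * Real.exp (-((κ₀ - κ) / 2 * d)) := by ring

/-- ★★ **THE COMBES–THOMAS ROW BUDGET FROM AN EXPONENTIAL MAJORANT, EVERY TORUS SIZE**: `|T i j| ≤ a·e^{−κ₀ d₁(loc i, loc j)}`, fibre multiplicity `mf`, `0 ≤ κ < κ₀` ⟹
`Σ_j |T i j|·(e^{κ d₁} − 1) ≤ a·κ·(2∕(e(κ₀−κ)))·(mf·c₀(1,(κ₀−κ)∕2)^ν)` (`ct_term_le` ∘ lit ✓`rowSum_decay_le` ∘ ✓`rowSum_torus`). [cite: Balaban1984PropagatorsII, Lemma 2.1 (2.61) p.234] -/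
theorem ctRowSum_le_of_expMajorant (loc : p → UT Nf) {T : Matrix p p ℝ} {a κ₀ κ : ℝ} {mf : ℕ}
    (hκ : 0 ≤ κ) (hκκ₀ : κ < κ₀) (hfib : ∀ y : UT Nf, (univ.filter fun k => loc k = y).card ≤ mf)
    (hmaj : ∀ i j, |T i j| ≤ a * Real.exp (-(κ₀ * tdist1 Nf (loc i) (loc j)))) (i : p) :
    ∑ j, |T i j| * (Real.exp (κ * tdist1 Nf (loc i) (loc j)) - 1)
      ≤ a * κ * (2 / (Real.exp 1 * (κ₀ - κ))) * (mf * B6.c0 1 ((κ₀ - κ) / 2) ^ ν) := by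
  classical
  have hα : 0 < κ₀ - κ := sub_pos.2 hκκ₀
  have ha : 0 ≤ a := by
    have h0 : 0 ≤ a * Real.exp (-(κ₀ * tdist1 Nf (loc i) (loc i))) := (abs_nonneg _).trans (hmaj i i)
    exact nonneg_of_mul_nonneg_left (by rwa [mul_comm] at h0) (Real.exp_pos _)
  calc ∑ j, |T i j| * (Real.exp (κ * tdist1 Nf (loc i) (loc j)) - 1)
      ≤ ∑ j, a * κ * (2 / (Real.exp 1 * (κ₀ - κ))) * Real.exp (-((κ₀ - κ) / 2 * tdist1 Nf (loc i) (loc j))) :=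
        Finset.sum_le_sum fun j _ => ct_term_le (hmaj i j) (tdist1_nonneg _ _) hκ hκκ₀
    _ ≤ a * κ * (2 / (Real.exp 1 * (κ₀ - κ))) * (mf * B6.c0 1 ((κ₀ - κ) / 2) ^ ν) :=
        rowSum_decay_le (by positivity) hfib (fun x => rowSum_torus Nf (half_pos hα) x) i

/-- ★★ **THE COLUMN BUDGET** (symmetry of `d₁`; lit ✓`colSum_decay_le`). [cite: Balaban1984PropagatorsII, Lemma 2.1 (2.61) p.234] -/
theorem ctColSum_le_of_expMajorant (loc : p → UT Nf) {T : Matrix p p ℝ} {a κ₀ κ : ℝ} {mf : ℕ}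
    (hκ : 0 ≤ κ) (hκκ₀ : κ < κ₀) (hfib : ∀ y : UT Nf, (univ.filter fun k => loc k = y).card ≤ mf)
    (hmaj : ∀ i j, |T i j| ≤ a * Real.exp (-(κ₀ * tdist1 Nf (loc i) (loc j)))) (j : p) :
    ∑ i, |T i j| * (Real.exp (κ * tdist1 Nf (loc i) (loc j)) - 1)
      ≤ a * κ * (2 / (Real.exp 1 * (κ₀ - κ))) * (mf * B6.c0 1 ((κ₀ - κ) / 2) ^ ν) := by
  classical
  have hα : 0 < κ₀ - κ := sub_pos.2 hκκ₀
  have ha : 0 ≤ a := by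
    have h0 : 0 ≤ a * Real.exp (-(κ₀ * tdist1 Nf (loc j) (loc j))) := (abs_nonneg _).trans (hmaj j j)
    exact nonneg_of_mul_nonneg_left (by rwa [mul_comm] at h0) (Real.exp_pos _)
  calc ∑ i, |T i j| * (Real.exp (κ * tdist1 Nf (loc i) (loc j)) - 1)
      ≤ ∑ i, a * κ * (2 / (Real.exp 1 * (κ₀ - κ))) * Real.exp (-((κ₀ - κ) / 2 * tdist1 Nf (loc i) (loc j))) :=
        Finset.sum_le_sum fun i _ => ct_term_le (hmaj i j) (tdist1_nonneg _ _) hκ hκκ₀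
    _ ≤ a * κ * (2 / (Real.exp 1 * (κ₀ - κ))) * (mf * B6.c0 1 ((κ₀ - κ) / 2) ^ ν) :=
        colSum_decay_le (by positivity) hfib (fun x => rowSum_torus Nf (half_pos hα) x) j

end CT

/-! ## §3 (Dwhite∣MW) with L2-b struck -/

section Dock

variable {ν : ℕ} {Nf : Fin ν → ℕ} [∀ i, NeZero (Nf i)]
variable {p : Type} [Fintype p] [DecidableEq p]

/-- ★★★ **(Dwhite∣MW) ON PRINT'S TWO OBJECTS, L2-b STRUCK** — ✓(L62) `dwhite_of_decayingTubeOperator` with `(ρ B) (hB0 hρ) (hdec)` DELETED and, in their place, the REAL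
operator's letters on the enlarged window `θ⁺ = θ_j + 4·√3·R₁`: (K-symm) `hKs`, (K-coer) `hcoerp` (now on `θ⁺`; the centre form follows by ✓`plaqSmall_mono`), (K-decay-real)
`hKd`, a rate `0 ≤ κ < κK` with the Combes–Thomas budget `hct` and `hρct : ρct < γK`; `hkW` read at `(B, ρ) := (2(√(γK − ρct))⁻¹, κ∕2)`.  CONCLUSION = ✓(L52)'s =
✓`dlinkPath∕Square_of_dmin_dwhite`'s `hDwhite` text VERBATIM.  Proof: §2 ⟹ the CT budget at every `θ⁺`-small `V′`, §1 ⟹ (K-sqrt-decay) with `(B, ρ)` as displayed, ✓(L62).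
[cite: Balaban1988RG2Cluster, (2.5)-(2.7) pp.12-13, p.15; Balaban1985BackgroundPropagators, Thm 3.4 p.400, Thm 3.10 (3.108) p.416, Thm 3.11 p.416, p.428; Balaban1984PropagatorsII, Lemma 2.1 (2.61) p.234] -/
theorem dwhite_of_symmetricDecayingOperator (F : T3Family) (γ b₀ p₀ : ℝ) (j Ts : ℕ) {Z : Type}
    (Φ : GaugeField (F.P j) 0 ↥(Matrix.specialUnitaryGroup (Fin 2) ℂ) × Z → GaugeField (F.P Ts) 0 ↥(Matrix.specialUnitaryGroup (Fin 2) ℂ))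
    (Wh : GaugeField (F.P j) 0 ↥(Matrix.specialUnitaryGroup (Fin 2) ℂ) → Z → PBond (F.P Ts) 0 → (Fin 3 → ℝ))
    (loc : p → UT Nf) (idx : PBond (F.P Ts) 0 → Fin 3 → p) (coord : Z → p → ℂ)
    (Kc : (PBond (F.P j) 0 → Matrix (Fin 2) (Fin 2) ℂ) → Matrix p p ℂ)
    (K : GaugeField (F.P j) 0 ↥(Matrix.specialUnitaryGroup (Fin 2) ℂ) → Matrix p p ℝ)
    (δt rt : ℝ) (hrt0 : 0 < rt) (hrt : Real.exp (6 * rt) ≤ 1 + δt)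
    -- (K-tube-holo) + (K-decay): L2-c on the tubes around every `θ_j`-small `V`; fibre multiplicity of `loc`
    (hKc : ∀ V : GaugeField (F.P j) 0 ↥(Matrix.specialUnitaryGroup (Fin 2) ℂ), PlaqSmall (θBal F.L γ b₀ p₀ j) V →
      ∀ i j', DifferentiableOn ℂ (fun W => Kc W i j') ((CplxModel.specialUnitary (Fin 2)).cplxTube δt V))
    (a κ₀ : ℝ) (mf : ℕ) (ha : 0 ≤ a) (hκ₀ : 0 < κ₀)
    (hfib : ∀ y : UT Nf, (univ.filter fun k => loc k = y).card ≤ mf)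
    (hKdec : ∀ V : GaugeField (F.P j) 0 ↥(Matrix.specialUnitaryGroup (Fin 2) ℂ), PlaqSmall (θBal F.L γ b₀ p₀ j) V →
      ∀ W ∈ (CplxModel.specialUnitary (Fin 2)).cplxTube δt V, ∀ i j', ‖Kc W i j'‖ ≤ a * Real.exp (-(κ₀ * tdist1 Nf (loc i) (loc j'))))
    -- radii; the margin condition with the torus-size-free row sum (as in ✓(L62))
    (γK R₁ r δ₀ Zw : ℝ) (hγK : 0 < γK) (hR₁ : 0 < R₁) (hR₁rt : R₁ ≤ rt)
    (hsmall : 2 * (a * (mf * B6.c0 1 κ₀ ^ ν)) * R₁ / rt ≤ γK / 2)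
    (hr0 : 0 < r) (hr1 : r < 1) (hZw : 0 ≤ Zw) (hδ₀R : δ₀ < r / (1 + r) * R₁ / 2)
    -- THE REAL OPERATOR on the enlarged window `θ_j + 4·√3·R₁`: (K-real), (K-symm), (K-coer) = L2-a, (K-decay-real)
    (hKreal : ∀ V' : GaugeField (F.P j) 0 ↥(Matrix.specialUnitaryGroup (Fin 2) ℂ), PlaqSmall (θBal F.L γ b₀ p₀ j + 4 * (Real.sqrt 3 * R₁)) V' →
      Kc ((CplxModel.specialUnitary (Fin 2)).embed V') = (K V').map (algebraMap ℝ ℂ))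
    (hKs : ∀ V' : GaugeField (F.P j) 0 ↥(Matrix.specialUnitaryGroup (Fin 2) ℂ), PlaqSmall (θBal F.L γ b₀ p₀ j + 4 * (Real.sqrt 3 * R₁)) V' → (K V').IsHermitian)
    (hcoerp : ∀ V' : GaugeField (F.P j) 0 ↥(Matrix.specialUnitaryGroup (Fin 2) ℂ), PlaqSmall (θBal F.L γ b₀ p₀ j + 4 * (Real.sqrt 3 * R₁)) V' → Coercive (K V') γK)
    (aK κK : ℝ)
    (hKd : ∀ V' : GaugeField (F.P j) 0 ↥(Matrix.specialUnitaryGroup (Fin 2) ℂ), PlaqSmall (θBal F.L γ b₀ p₀ j + 4 * (Real.sqrt 3 * R₁)) V' →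
      ∀ i j', |K V' i j'| ≤ aK * Real.exp (-(κK * tdist1 Nf (loc i) (loc j'))))
    -- the Combes–Thomas rate and budget
    (κ ρct : ℝ) (hκ : 0 ≤ κ) (hκK : κ < κK)
    (hct : aK * κ * (2 / (Real.exp 1 * (κK - κ))) * (mf * B6.c0 1 ((κK - κ) / 2) ^ ν) ≤ ρct) (hρct : ρct < γK)
    -- (Wh-read-K)
    (hWh : ∀ V' : GaugeField (F.P j) 0 ↥(Matrix.specialUnitaryGroup (Fin 2) ℂ), PlaqSmall (θBal F.L γ b₀ p₀ j) V' →
      ∀ (z : Z) (e : PBond (F.P Ts) 0) (k : Fin 3), Wh V' z e k = ((invSqrt ((K V').map (algebraMap ℝ ℂ)) *ᵥ coord z) (idx e k)).re)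
    -- (z-window∣MW) VERBATIM
    (hwin : ∀ (z : Z) (V : GaugeField (F.P j) 0 ↥(Matrix.specialUnitaryGroup (Fin 2) ℂ)) (b : PBond (F.P j) 0) (u : Fin 3 → ℝ), PlaqSmall (θBal F.L γ b₀ p₀ j) V →
      PlaqSmall (θBal F.L γ b₀ p₀ j) (update V b (V b * expPt u)) → ‖u‖ ≤ δ₀ →
      (∀ r ∈ Set.Ioo (0:ℝ) 1, ∀ (n : ℕ) (hjn : j + 1 ≤ n) (hnK : n ≤ Ts), PlaqSmall (24 / 25 * θBal F.L γ b₀ p₀ n) (descendTo F ℰp n Ts hnK (Φ (update V b (V b * expPt (r • u)), z)))) →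
      ∀ j', ‖coord z j'‖ ≤ Zw)
    -- the consumer's modulus dominates the row-sum shape at `(B, ρ) := (2(√(γK − ρct))⁻¹, κ∕2)` and margin `γK∕2`
    (kW : PBond (F.P Ts) 0 → ℝ)
    (hkW : ∀ e k, (4 / (r / (1 + r) * R₁)) *
          (∑ j', ((2 * (Real.sqrt (γK - ρct))⁻¹) ^ (1 - lam r) * (max (2 * (Real.sqrt (γK - ρct))⁻¹) (2 / Real.sqrt (γK / 2))) ^ lam r) *
            Real.exp (-((1 - lam r) * (κ / 2) * tdist1 Nf (loc (idx e k)) (loc j')))) * Zw ≤ kW e) :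
    ∀ (z : Z) (V : GaugeField (F.P j) 0 ↥(Matrix.specialUnitaryGroup (Fin 2) ℂ)) (b : PBond (F.P j) 0) (u : Fin 3 → ℝ), PlaqSmall (θBal F.L γ b₀ p₀ j) V →
      PlaqSmall (θBal F.L γ b₀ p₀ j) (update V b (V b * expPt u)) → ‖u‖ ≤ δ₀ →
      (∀ r ∈ Set.Ioo (0:ℝ) 1, ∀ (n : ℕ) (hjn : j + 1 ≤ n) (hnK : n ≤ Ts), PlaqSmall (24 / 25 * θBal F.L γ b₀ p₀ n) (descendTo F ℰp n Ts hnK (Φ (update V b (V b * expPt (r • u)), z)))) →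
      ∀ e, ‖Wh (update V b (V b * expPt u)) z e - Wh V z e‖ ≤ kW e * ‖u‖ := by
  have h3 : 0 ≤ Real.sqrt 3 := Real.sqrt_nonneg 3
  -- (K-coer) at the centres from the enlarged window
  have hcoer : ∀ V : GaugeField (F.P j) 0 ↥(Matrix.specialUnitaryGroup (Fin 2) ℂ), PlaqSmall (θBal F.L γ b₀ p₀ j) V → Coercive (K V) γK :=
    fun V hV => hcoerp V (plaqSmall_mono (by nlinarith [hR₁.le]) hV)
  -- (K-sqrt-decay) at `(B, ρ) := (2(√(γK − ρct))⁻¹, κ∕2)` from §1 ∘ §2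
  have hdec : ∀ V' : GaugeField (F.P j) 0 ↥(Matrix.specialUnitaryGroup (Fin 2) ℂ), PlaqSmall (θBal F.L γ b₀ p₀ j + 4 * (Real.sqrt 3 * R₁)) V' →
      ∀ i j', ‖invSqrt ((K V').map (algebraMap ℝ ℂ)) i j'‖
        ≤ 2 * (Real.sqrt (γK - ρct))⁻¹ * Real.exp (-(κ / 2 * tdist1 Nf (loc i) (loc j'))) := by
    intro V' hV' i j'
    exact norm_invSqrt_map_le_of_coercive_ct loc (hKs V' hV') hρct hκ (hcoerp V' hV')
      (fun i => (ctRowSum_le_of_expMajorant loc hκ hκK hfib (hKd V' hV') i).trans hct)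
      (fun j' => (ctColSum_le_of_expMajorant loc hκ hκK hfib (hKd V' hV') j').trans hct) i j'
  exact dwhite_of_decayingTubeOperator F γ b₀ p₀ j Ts Φ Wh loc idx coord Kc K δt rt hrt0 hrt hKc a κ₀ mf ha hκ₀ hfib hKdec γK hγK hcoer
    (κ / 2) (2 * (Real.sqrt (γK - ρct))⁻¹) R₁ r δ₀ Zw (by positivity) (by positivity) hR₁ hR₁rt hsmall hr0 hr1 hZw hδ₀R hKreal hdec hWh hwin kW hkW

end Dock

end Summit.QuantumFields.YangMills.Theorems.OrganTangentSqrtDecayOfRealDecay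

end
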